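import Summits.HubbardSuperconductivity.HubbardSuperconductivity.Theorems.AnisotropyChordTransferFibre3RowDCellCheck
import Summits.HubbardSuperconductivity.HubbardSuperconductivity.Theorems.AnisotropyChordTransferFibre3RowDTAtoms
import Summits.HubbardSuperconductivity.HubbardSuperconductivity.Theorems.AnisotropyChordTransferFibre3RowDTRhoBound
import Summits.HubbardSuperconductivity.HubbardSuperconductivity.Theorems.AnisotropyChordTransferFibre3SideCondCellT
import Summits.HubbardSuperconductivity.HubbardSuperconductivity.Theorems.AnisotropyChordTransferFibre3RowDTCellCheck
import Summits.HubbardSuperconductivity.HubbardSuperconductivity.Theorems.AnisotropyChordTransferFibre3BlockSoundR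
import Summits.HubbardSuperconductivity.HubbardSuperconductivity.Theorems.AnisotropyChordTransferFibre3RowDTAtomsR

/-!
# Route `AnisotropyChord` / H0 rotor rung, row D (KT-2a) on the t-BLOCKS with RING brackets: `…R` twins of `…RowDTCellCheck`

The theorems of `…RowDTCellCheck` that take the block-cell certificate `(hc : c.check = true)`, restated VERBATIM for RING-checked cells
(`hc : c.checkR = true`, p2's `L2.TCell.checkR` of `…L2TCellR`; box bridge `L2.N1.pmem_xTrueTR` / `RowC.finalVec_mem_of_cellFinalBoxTR`
of `…BlockSoundR`), names suffixed `R`: .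
Prover seat `hubbard-h0-rotor-p1` g32 (route lead; ASK 3 follow-up, p2 CLAIM 3 division «row-D/row-C cell-layer twins not by p2»);
helper for piece A = stmt-HubbardSuperconductivity-23918 of rung 19089 (`--supports`, helper class).  Nothing here proves superconductivity
in the Hubbard model.  Mathlib + the tree only; no sorry.
-/

set_option linter.dupNamespace false
set_option autoImplicit false

noncomputable section

open scoped BigOperators
open Literature.Analysis.ValidatedNumerics

namespace Summit.HubbardSuperconductivity.HubbardSuperconductivity.Theorems.AnisotropyChord.Transfer.Fibre3

namespace RowD

namespace T

open RowC L2 L2.N1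

variable (L : ℕ) [NeZero L]

variable (Δ lam2 : ℝ) (f : Tor L → ℝ)

/-- ★ `tauCheck ⇒ τlo·θ² ≤ T⁺ ≤ τhi·θ²` at a ground profile located in the cell. [folklore] -/
theorem tau_of_tauCheckR (c : L2.TCell) (a1 a2 τlo τhi : ℚ) (pi : ℕ × ℕ)
    (hchk : tauCheck c a1 a2 τlo τhi pi = true) (hc : c.checkR = true) (hL : 64 ≤ L) (hL0 : c.L0 ≤ L) (hL1 : c.L1 = 0 ∨ L ≤ c.L1)
    (hΔ0 : 0 ≤ Δ) (hΔ1 : Δ < 1) (hf : IsGroundTwoMagnon L Δ lam2 f)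
    (hν1 : (c.n1 : ℝ) / c.νd ≤ lam2 / (2 * Real.pi / L) ^ 2) (hν2 : lam2 / (2 * Real.pi / L) ^ 2 ≤ (c.n2 : ℝ) / c.νd)
    (ha1 : ((a1 : ℚ) : ℝ) ≤ Δ * f (K1 L)) (ha2 : Δ * f (K1 L) ≤ ((a2 : ℚ) : ℝ)) :
    (τlo : ℝ) * (2 * Real.pi / L) ^ 2 ≤ Tplus L Δ f ∧ Tplus L Δ f ≤ (τhi : ℝ) * (2 * Real.pi / L) ^ 2 := by
  have hLpos : (0 : ℝ) < L := by exact_mod_cast (show 0 < L by omega)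
  have ht : 0 < (2 * Real.pi / L : ℝ) ^ 2 := by positivity
  unfold tauCheck at hchk
  split at hchk
  · exact absurd hchk (by simp)
  · rename_i F hF
    simp only [Bool.and_eq_true] at hchk
    obtain ⟨⟨hP, hhi⟩, hlo⟩ := hchk
    obtain ⟨y, hmem, g0, -, g2, -, -, g6, g8⟩ :=
      finalVec_mem_of_cellFinalBoxTR L c a1 a2 pi hF hc (by omega) hL0 hL1 hΔ0 hΔ1 hf hν1 hν2 ha1 ha2
    have eP := rexprLeOn_sound hP _ hmem
    have ehi := rexprLeOn_sound hhi _ hmem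
    have elo := rexprLeOn_sound hlo _ hmem
    simp only [yP, RExpr.eval] at eP
    simp only [RExpr.eval, cst, eval_tauE] at ehi elo
    push_cast at eP ehi elo
    have hvP : 0 < ((2 * Real.pi / L) ^ 2) ^ 3 * ∑ k : Tor L, F2 L f k ^ 3 := by rw [← g6]; linarith
    have hT := Tplus_eq_tau L (by omega) hf hvP
    rw [← g6, ← g8, ← g2] at hT
    rw [hT]
    constructor <;> nlinarith


/-- the true row-D vector lies in the row-D box (prefix membership + zero tail). [folklore] -/
theorem rowDBox_memR (c : L2.TCell) (a1 a2 : ℚ) (pi : ℕ × ℕ) {B' : Box}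
    (hB' : rowDBox c a1 a2 pi = some B') (hc : c.checkR = true) (hL : 64 ≤ L) (hL0 : c.L0 ≤ L) (hL1 : c.L1 = 0 ∨ L ≤ c.L1)
    (hΔ0 : 0 ≤ Δ) (hΔ1 : Δ < 1) (hf : IsGroundTwoMagnon L Δ lam2 f)
    (hν1 : (c.n1 : ℝ) / c.νd ≤ lam2 / (2 * Real.pi / L) ^ 2) (hν2 : lam2 / (2 * Real.pi / L) ^ 2 ≤ (c.n2 : ℝ) / c.νd)
    (ha1 : ((a1 : ℚ) : ℝ) ≤ Δ * f (K1 L)) (ha2 : Δ * f (K1 L) ≤ ((a2 : ℚ) : ℝ)) :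
    B'.mem (xTrueD L Δ lam2 f) := by
  obtain ⟨hP, hlen⟩ := rowDBox_pmemR L c a1 a2 pi hB' hc hL hL0 hL1 hΔ0 hΔ1 hf hν1 hν2 ha1 ha2
  intro i
  by_cases hi : i < B'.length
  · exact hP i hi
  · have hz : xTrueD L Δ lam2 f i = 0 := by
      unfold xTrueD; rw [if_neg (by omega), if_neg (by omega)]
    rw [hz]
    unfold Box.ivl
    rw [List.getD_eq_getElem?_getD, List.getElem?_eq_none (by omega)]
    simp


/-- ★★★ **A PASSING ROW-D CHECK (+ `τ` CHECK) GIVES THE (KT-2a″) BOUND `lowG ≤ a_D·η_eff·U` FOR EVERY `L ≥ 128` ON THE CELL.** -/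
theorem lowG_of_rowDCheckR (c : L2.TCell) (a1 a2 aD τlo τhi : ℚ) (pi piT : ℕ × ℕ)
    (hchk : rowDCheck c a1 a2 aD τlo τhi pi = true) (hτ : tauCheck c a1 a2 τlo τhi piT = true)
    (hc : c.checkR = true) (hL : 64 ≤ L) (hL0 : c.L0 ≤ L) (hL1 : c.L1 = 0 ∨ L ≤ c.L1)
    (hΔ0 : 0 ≤ Δ) (hΔ1 : Δ < 1) (hf : IsGroundTwoMagnon L Δ lam2 f)
    (hν1 : (c.n1 : ℝ) / c.νd ≤ lam2 / (2 * Real.pi / L) ^ 2) (hν2 : lam2 / (2 * Real.pi / L) ^ 2 ≤ (c.n2 : ℝ) / c.νd)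
    (ha1 : ((a1 : ℚ) : ℝ) ≤ Δ * f (K1 L)) (ha2 : Δ * f (K1 L) ≤ ((a2 : ℚ) : ℝ)) :
    lowGForm L Δ f ≤ (aD : ℝ) * etaEff L lam2 * Uunit L Δ f := by
  have hLpos : (0 : ℝ) < L := by exact_mod_cast (show 0 < L by omega)
  have ht : 0 < (2 * Real.pi / L : ℝ) ^ 2 := by positivity
  have hV : (0 : ℝ) < (L : ℝ) ^ 2 := by positivity
  obtain ⟨hτlo, hτhi⟩ := tau_of_tauCheckR L Δ lam2 f c a1 a2 τlo τhi piT hτ hc hL hL0 hL1 hΔ0 hΔ1 hf hν1 hν2 ha1 ha2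
  -- unpack the check
  unfold rowDCheck at hchk
  simp only [Bool.and_eq_true, decide_eq_true_eq] at hchk
  obtain ⟨⟨haD, hτlo0⟩, hrest⟩ := hchk
  split at hrest
  · exact absurd hrest (by simp)
  · rename_i B hB
    simp only [Bool.and_eq_true] at hrest
    obtain ⟨hE1, hTot⟩ := hrest
    have hmem := rowDBox_memR L Δ lam2 f c a1 a2 pi hB hc hL hL0 hL1 hΔ0 hΔ1 hf hν1 hν2 ha1 ha2
    have e1 := rexprLeOn_sound hE1 _ hmem
    have eTot := rexprLeOn_sound hTot _ hmem
    simp only [RExpr.eval, cst, vE1, xTrueD_e1] at e1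
    push_cast at e1
    have he1 : (τhi : ℝ) - 2 * (eps1 L / (2 * Real.pi / L) ^ 2) ≤ -1 / 1000 := by linarith
    -- the termwise bound, summed
    have hsum : lowGForm L Δ f ≤ ((L : ℝ) ^ 2) ^ 2 * (2 * Real.pi / L) ^ 2
        * (sumE (lowList.map fun kk => termE τlo τhi kk.1 kk.2)).eval (xTrueD L Δ lam2 f) := by
      rw [lowGForm_eq_listsum L Δ f (by omega)]
      have := listsum_le lowList
        (fun kk => Complex.normSq (cfgDFT L (resid L Δ f) (B1.toTor L kk.1) (B1.toTor L kk.2))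
          / (((L : ℝ) ^ 2) ^ 2 * den L (Tplus L Δ f) (B1.toTor L kk.1) (B1.toTor L kk.2)))
        (fun kk => ((L : ℝ) ^ 2) ^ 2 * (2 * Real.pi / L) ^ 2 * (termE τlo τhi kk.1 kk.2).eval (xTrueD L Δ lam2 f))
        (fun kk hkk => class_le L Δ lam2 f hL hΔ0 hΔ1 hf τlo τhi hτlo hτhi he1 hkk)
      refine this.trans (le_of_eq ?_)
      simp only [eval_sumE, List.map_map, Function.comp_def, List.sum_map_mul_left]
    -- the total check
    simp only [totalE, RExpr.eval, cst, vPi2, vNu, xTrueD_one, xTrueD_two] at eTot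
    push_cast at eTot
    -- the right-hand side
    have hRHS : (aD : ℝ) * etaEff L lam2 * Uunit L Δ f
        = ((L : ℝ) ^ 2) ^ 2 * (2 * Real.pi / L) ^ 2 * (3 * aD * (Real.pi ^ 2 * (lam2 / (2 * Real.pi / L) ^ 2)))
          * (Tplus L Δ f / (2 * Real.pi / L) ^ 2) := by
      have hL0 : (L : ℝ) ≠ 0 := hLpos.ne'
      have hπ : Real.pi ≠ 0 := Real.pi_ne_zero
      unfold Uunit etaEff
      field_simp
      ring
    rw [hRHS]
    have hτ' : (τlo : ℝ) ≤ Tplus L Δ f / (2 * Real.pi / L) ^ 2 := by rw [le_div_iff₀ ht]; exact hτlo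
    have hc0 : 0 ≤ ((L : ℝ) ^ 2) ^ 2 * (2 * Real.pi / L) ^ 2 * (3 * aD * (Real.pi ^ 2 * (lam2 / (2 * Real.pi / L) ^ 2))) := by
      have : (0 : ℝ) ≤ aD := by exact_mod_cast haD
      have hlam : 0 < lam2 := lam2_pos L (by omega) hΔ1 hf.1
      positivity
    have hVt : 0 < ((L : ℝ) ^ 2) ^ 2 * (2 * Real.pi / L) ^ 2 := by positivity
    calc lowGForm L Δ f ≤ ((L : ℝ) ^ 2) ^ 2 * (2 * Real.pi / L) ^ 2
          * (sumE (lowList.map fun kk => termE τlo τhi kk.1 kk.2)).eval (xTrueD L Δ lam2 f) := hsum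
      _ ≤ ((L : ℝ) ^ 2) ^ 2 * (2 * Real.pi / L) ^ 2 * ((3 * aD * τlo) * Real.pi ^ 2 * (lam2 / (2 * Real.pi / L) ^ 2)) :=
          mul_le_mul_of_nonneg_left (by linarith) hVt.le
      _ = ((L : ℝ) ^ 2) ^ 2 * (2 * Real.pi / L) ^ 2 * (3 * aD * (Real.pi ^ 2 * (lam2 / (2 * Real.pi / L) ^ 2))) * τlo := by ring
      _ ≤ _ := mul_le_mul_of_nonneg_left hτ' hc0



/-- ★★★ **PER-CLASS FORM**: a budget table `tbl = [(k, b_k)]` listing the classes of `lowList` in order, each row certified by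
`classCheck` (one small kernel `decide` per class), with `Σ b_k ≤ 3·(98696/10000)·aD·ν₁·τlo` (`9.8696 < π²`, `ν₁ = n₁/νd` the cell's
lower `ν`), the `ê₁` check and the `τ` check give `lowG ≤ a_D·η_eff·U` on the cell. -/
theorem lowG_of_classChecksR (c : L2.TCell) (a1 a2 aD τlo τhi : ℚ) (pi piT : ℕ × ℕ) (tbl : List (((ℤ × ℤ) × (ℤ × ℤ)) × ℚ))
    (htbl : tbl.map Prod.fst = lowList)
    (hcls : (tbl.all fun p => classCheck c a1 a2 τlo τhi pi p.1 p.2) = true)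
    (hsum : (tbl.map Prod.snd).sum ≤ 3 * (98696 / 10000) * aD * ((c.n1 : ℚ) / c.νd) * τlo)
    (haD : 0 ≤ aD) (hτlo0 : 0 ≤ τlo) (he1 : e1Check c a1 a2 τhi pi = true) (hτ : tauCheck c a1 a2 τlo τhi piT = true)
    (hc : c.checkR = true) (hL : 64 ≤ L) (hL0 : c.L0 ≤ L) (hL1 : c.L1 = 0 ∨ L ≤ c.L1)
    (hΔ0 : 0 ≤ Δ) (hΔ1 : Δ < 1) (hf : IsGroundTwoMagnon L Δ lam2 f)
    (hν1 : (c.n1 : ℝ) / c.νd ≤ lam2 / (2 * Real.pi / L) ^ 2) (hν2 : lam2 / (2 * Real.pi / L) ^ 2 ≤ (c.n2 : ℝ) / c.νd)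
    (ha1 : ((a1 : ℚ) : ℝ) ≤ Δ * f (K1 L)) (ha2 : Δ * f (K1 L) ≤ ((a2 : ℚ) : ℝ)) :
    lowGForm L Δ f ≤ (aD : ℝ) * etaEff L lam2 * Uunit L Δ f := by
  have hLpos : (0 : ℝ) < L := by exact_mod_cast (show 0 < L by omega)
  have ht : 0 < (2 * Real.pi / L : ℝ) ^ 2 := by positivity
  have hV : (0 : ℝ) < (L : ℝ) ^ 2 := by positivity
  obtain ⟨hτlo, hτhi⟩ := tau_of_tauCheckR L Δ lam2 f c a1 a2 τlo τhi piT hτ hc hL hL0 hL1 hΔ0 hΔ1 hf hν1 hν2 ha1 ha2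
  -- the box and the `ê₁` check
  unfold e1Check at he1
  split at he1
  · exact absurd he1 (by simp)
  · rename_i B hB
    have hmem := rowDBox_memR L Δ lam2 f c a1 a2 pi hB hc hL hL0 hL1 hΔ0 hΔ1 hf hν1 hν2 ha1 ha2
    have e1 := rexprLeOn_sound he1 _ hmem
    simp only [RExpr.eval, cst, vE1, xTrueD_e1] at e1
    push_cast at e1
    have he1' : (τhi : ℝ) - 2 * (eps1 L / (2 * Real.pi / L) ^ 2) ≤ -1 / 1000 := by linarith
    -- each row of the table: `term(k) ≤ V²t·termE.eval ≤ V²t·b_k`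
    have hcl : ∀ p ∈ tbl,
        Complex.normSq (cfgDFT L (resid L Δ f) (B1.toTor L p.1.1) (B1.toTor L p.1.2))
          / (((L : ℝ) ^ 2) ^ 2 * den L (Tplus L Δ f) (B1.toTor L p.1.1) (B1.toTor L p.1.2))
        ≤ ((L : ℝ) ^ 2) ^ 2 * (2 * Real.pi / L) ^ 2 * ((p.2 : ℚ) : ℝ) := by
      intro p hp
      have hkk : p.1 ∈ lowList := htbl ▸ List.mem_map_of_mem hp
      have h1 := class_le L Δ lam2 f hL hΔ0 hΔ1 hf τlo τhi hτlo hτhi he1' hkk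
      have h2 := List.all_eq_true.mp hcls p hp
      unfold classCheck at h2
      rw [hB] at h2
      have h3 := rexprLeOn_sound h2 _ hmem
      exact h1.trans (mul_le_mul_of_nonneg_left h3 (by positivity))
    have hsum' : lowGForm L Δ f ≤ ((L : ℝ) ^ 2) ^ 2 * (2 * Real.pi / L) ^ 2 * (((tbl.map Prod.snd).sum : ℚ) : ℝ) := by
      rw [lowGForm_eq_listsum L Δ f (by omega), ← htbl, List.map_map]
      have := listsum_le tbl _ (fun p => ((L : ℝ) ^ 2) ^ 2 * (2 * Real.pi / L) ^ 2 * ((p.2 : ℚ) : ℝ)) hcl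
      refine this.trans (le_of_eq ?_)
      rw [List.sum_map_mul_left, Rat.cast_list_sum, List.map_map]
      rfl
    -- the budget inequality in `ℝ`
    have hsumR : (((tbl.map Prod.snd).sum : ℚ) : ℝ) ≤ 3 * (98696 / 10000) * aD * ((c.n1 : ℝ) / c.νd) * τlo := by
      have := (Rat.cast_le (K := ℝ)).mpr hsum
      push_cast at this ⊢
      exact this
    have hπ2 : (98696 / 10000 : ℝ) ≤ Real.pi ^ 2 := by nlinarith [Real.pi_gt_d6, Real.pi_pos]
    have haD' : (0 : ℝ) ≤ aD := by exact_mod_cast haD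
    have hτ0' : (0 : ℝ) ≤ τlo := by exact_mod_cast hτlo0
    have hlam : 0 < lam2 := lam2_pos L (by omega) hΔ1 hf.1
    have hlt : 0 ≤ lam2 / (2 * Real.pi / L) ^ 2 := by positivity
    have hν' : 3 * (98696 / 10000) * (aD : ℝ) * ((c.n1 : ℝ) / c.νd) * τlo
        ≤ 3 * Real.pi ^ 2 * aD * (lam2 / (2 * Real.pi / L) ^ 2) * τlo := by
      have h1 : 0 ≤ (aD : ℝ) * τlo * (lam2 / (2 * Real.pi / L) ^ 2 - (c.n1 : ℝ) / c.νd) :=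
        mul_nonneg (mul_nonneg haD' hτ0') (sub_nonneg.2 hν1)
      have h2 : 0 ≤ (aD : ℝ) * τlo * (lam2 / (2 * Real.pi / L) ^ 2) * (Real.pi ^ 2 - 98696 / 10000) :=
        mul_nonneg (mul_nonneg (mul_nonneg haD' hτ0') hlt) (sub_nonneg.2 hπ2)
      nlinarith [h1, h2]
    have hRHS : (aD : ℝ) * etaEff L lam2 * Uunit L Δ f
        = ((L : ℝ) ^ 2) ^ 2 * (2 * Real.pi / L) ^ 2 * (3 * Real.pi ^ 2 * aD * (lam2 / (2 * Real.pi / L) ^ 2))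
          * (Tplus L Δ f / (2 * Real.pi / L) ^ 2) := by
      have hL0 : (L : ℝ) ≠ 0 := hLpos.ne'
      have hπ : Real.pi ≠ 0 := Real.pi_ne_zero
      unfold Uunit etaEff
      field_simp
      ring
    rw [hRHS]
    have hτ' : (τlo : ℝ) ≤ Tplus L Δ f / (2 * Real.pi / L) ^ 2 := by rw [le_div_iff₀ ht]; exact hτlo
    have hc0 : 0 ≤ ((L : ℝ) ^ 2) ^ 2 * (2 * Real.pi / L) ^ 2 * (3 * Real.pi ^ 2 * aD * (lam2 / (2 * Real.pi / L) ^ 2)) := by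
      positivity
    have hVt : 0 ≤ ((L : ℝ) ^ 2) ^ 2 * (2 * Real.pi / L) ^ 2 := by positivity
    calc lowGForm L Δ f ≤ ((L : ℝ) ^ 2) ^ 2 * (2 * Real.pi / L) ^ 2 * (((tbl.map Prod.snd).sum : ℚ) : ℝ) := hsum'
      _ ≤ ((L : ℝ) ^ 2) ^ 2 * (2 * Real.pi / L) ^ 2 * (3 * Real.pi ^ 2 * aD * (lam2 / (2 * Real.pi / L) ^ 2) * τlo) :=
          mul_le_mul_of_nonneg_left (hsumR.trans (by linarith)) hVt
      _ = ((L : ℝ) ^ 2) ^ 2 * (2 * Real.pi / L) ^ 2 * (3 * Real.pi ^ 2 * aD * (lam2 / (2 * Real.pi / L) ^ 2)) * τlo := by ring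
      _ ≤ _ := mul_le_mul_of_nonneg_left hτ' hc0

end T

end RowD

end Summit.HubbardSuperconductivity.HubbardSuperconductivity.Theorems.AnisotropyChord.Transfer.Fibre3

end
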